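import Mathlib
import Literature.Computability.Complexity.CliqueTestGraphs

/-!
# PneNP / ConvexRankGates — `ConvexGateBlind`: the test-cover lower bound (an ε-sensitive method)

Helpers (`--supports stmt-PneNP-10680`). Every lower-bound functional that is continuous in the matrix dies on the
shifted clique-distance matrices `D - εJ` as `ε → 0⁺` (the non-negative rank of `D` itself is only `#E`). This file
records a lower-bound method for the LP slice of the canonical form that is NOT continuous at `ε = 0`: a counting
("cover") argument with one linear TEST per column.

Let `D[Q,u] - ε = ∑_{l<r} U_{u,l} V_{l,Q}` with `U, V ≥ 0` (`Q` the `k`-sets, `u` in a finite family `𝒰` of columns).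
Give every `u ∈ 𝒰` a test `ψ_u : k-sets → ℝ` with `∑_Q ψ_u(Q)(D[Q,u] - ε) < 0`. Pairing the factorisation with `ψ_u`
gives `∑_l U_{u,l} ⟨ψ_u, V_l⟩ < 0`, so some generator `V_l` is CAUGHT by `u` (`⟨ψ_u, V_l⟩ < 0`). If no non-negative
function on `k`-sets is caught by more than `N` members of `𝒰`, then `#𝒰 ≤ r · N` (`card_le_mul_of_testCover`).
Tests with `∑_Q ψ_u(Q) D[Q,u] ≤ 0 < ∑_Q ψ_u(Q)` are valid for EVERY `ε > 0` at once and for no `ε ≤ 0`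
(`testCover_valid_of_le_of_pos`), which is where the discontinuity at `ε = 0` enters; the resulting ε-uniform bound
on the LP slice of the canonical statement is `lpConeRank_ge_of_testCover`. (Which test families make `N` small is the
combinatorial question this interface isolates; see the item's evidence notes.) [folklore counting; new packaging]
-/

namespace Summit.PneNP.PneNP.Theorems

open Finset Literature.Computability.Complexity

/-- **Some generator is caught.** If `∑_l c_l x_l < 0` with `c ≥ 0`, then some `x_l < 0`. [folklore] -/
theorem exists_neg_of_sum_mul_neg {r : ℕ} (c x : Fin r → ℝ) (hc : ∀ l, 0 ≤ c l) (h : ∑ l, c l * x l < 0) :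
    ∃ l, x l < 0 := by
  by_contra hcon
  push Not at hcon
  have : 0 ≤ ∑ l, c l * x l := Finset.sum_nonneg fun l _ => mul_nonneg (hc l) (hcon l)
  linarith

/-- **The test-cover lower bound** (matrix level, LP slice). Let `D[Q,u] - ε = ∑_{l<r} U_{u,l} V_{l,Q}` on the
`k`-sets `Q` for every column `u` of a finite family `𝒰`, with `U, V ≥ 0`. If every `u ∈ 𝒰` carries a test `ψ_u` with
`∑_{#Q = k} ψ_u(Q) (D[Q,u] - ε) < 0`, and no function `a ≥ 0` on the `k`-sets has `∑_Q ψ_u(Q) a(Q) < 0` for more than `N`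
members `u` of `𝒰`, then `#𝒰 ≤ r · N`. [folklore counting] -/
theorem card_le_mul_of_testCover {m k r N : ℕ}
    (U : ((⊤ : SimpleGraph (Fin m)).edgeSet → Bool) → Fin r → ℝ) (V : Fin r → Finset (Fin m) → ℝ)
    (hU : ∀ u l, 0 ≤ U u l) (hV : ∀ l Q, 0 ≤ V l Q) (ε : ℝ)
    (𝒰 : Finset ((⊤ : SimpleGraph (Fin m)).edgeSet → Bool))
    (hfact : ∀ u ∈ 𝒰, ∀ Q : Finset (Fin m), Q.card = k →
      (∑ e, if cliqueVec Q e = true ∧ u e = false then (1 : ℝ) else 0) - ε = ∑ l, U u l * V l Q)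
    (ψ : ((⊤ : SimpleGraph (Fin m)).edgeSet → Bool) → Finset (Fin m) → ℝ)
    (hψ : ∀ u ∈ 𝒰, ∑ Q ∈ (Finset.univ : Finset (Fin m)).powersetCard k,
      ψ u Q * ((∑ e, if cliqueVec Q e = true ∧ u e = false then (1 : ℝ) else 0) - ε) < 0)
    (hN : ∀ a : Finset (Fin m) → ℝ, (∀ Q : Finset (Fin m), Q.card = k → 0 ≤ a Q) →
      (𝒰.filter fun u => ∑ Q ∈ (Finset.univ : Finset (Fin m)).powersetCard k, ψ u Q * a Q < 0).card ≤ N) :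
    𝒰.card ≤ r * N := by
  classical
  -- every column catches some generator
  have hcatch : ∀ u ∈ 𝒰, ∃ l : Fin r,
      ∑ Q ∈ (Finset.univ : Finset (Fin m)).powersetCard k, ψ u Q * V l Q < 0 := by
    intro u hu
    have hlt := hψ u hu
    have hrw : ∑ Q ∈ (Finset.univ : Finset (Fin m)).powersetCard k,
        ψ u Q * ((∑ e, if cliqueVec Q e = true ∧ u e = false then (1 : ℝ) else 0) - ε) =
        ∑ l, U u l * ∑ Q ∈ (Finset.univ : Finset (Fin m)).powersetCard k, ψ u Q * V l Q := by
      have hstep : ∀ Q ∈ (Finset.univ : Finset (Fin m)).powersetCard k,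
          ψ u Q * ((∑ e, if cliqueVec Q e = true ∧ u e = false then (1 : ℝ) else 0) - ε) =
            ∑ l, U u l * (ψ u Q * V l Q) := by
        intro Q hQ
        have hQk : Q.card = k := (Finset.mem_powersetCard.1 hQ).2
        rw [hfact u hu Q hQk, Finset.mul_sum]
        exact Finset.sum_congr rfl fun l _ => by ring
      rw [Finset.sum_congr rfl hstep, Finset.sum_comm]
      exact Finset.sum_congr rfl fun l _ => by rw [Finset.mul_sum]
    rw [hrw] at hlt
    exact exists_neg_of_sum_mul_neg (fun l => U u l) _ (fun l => hU u l) hlt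
  calc 𝒰.card ≤ ((Finset.univ : Finset (Fin r)).biUnion fun l =>
        𝒰.filter fun u => ∑ Q ∈ (Finset.univ : Finset (Fin m)).powersetCard k, ψ u Q * V l Q < 0).card := by
        refine Finset.card_le_card fun u hu => ?_
        obtain ⟨l, hl⟩ := hcatch u hu
        exact Finset.mem_biUnion.2 ⟨l, Finset.mem_univ _, Finset.mem_filter.2 ⟨hu, hl⟩⟩
    _ ≤ ∑ l : Fin r, (𝒰.filter fun u => ∑ Q ∈ (Finset.univ : Finset (Fin m)).powersetCard k, ψ u Q * V l Q < 0).card :=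
        Finset.card_biUnion_le
    _ ≤ ∑ _l : Fin r, N := Finset.sum_le_sum fun l _ => hN (V l) (fun Q _ => hV l Q)
    _ = r * N := by rw [Finset.sum_const, Finset.card_univ, Fintype.card_fin, smul_eq_mul]

/-- **ε-free validity.** A test with `∑_Q ψ(Q) D[Q,u] ≤ 0 < ∑_Q ψ(Q)` is valid for the column `u` of `D - εJ` for
EVERY `ε > 0` (and for no `ε ≤ 0`: the method is discontinuous at `ε = 0`). [folklore] -/
theorem testCover_valid_of_le_of_pos {m k : ℕ} (ψ : Finset (Fin m) → ℝ)
    (u : (⊤ : SimpleGraph (Fin m)).edgeSet → Bool) (ε : ℝ) (hε : 0 < ε)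
    (hD : ∑ Q ∈ (Finset.univ : Finset (Fin m)).powersetCard k,
      ψ Q * (∑ e, if cliqueVec Q e = true ∧ u e = false then (1 : ℝ) else 0) ≤ 0)
    (hpos : 0 < ∑ Q ∈ (Finset.univ : Finset (Fin m)).powersetCard k, ψ Q) :
    ∑ Q ∈ (Finset.univ : Finset (Fin m)).powersetCard k,
      ψ Q * ((∑ e, if cliqueVec Q e = true ∧ u e = false then (1 : ℝ) else 0) - ε) < 0 := by
  have hsplit : ∑ Q ∈ (Finset.univ : Finset (Fin m)).powersetCard k,
      ψ Q * ((∑ e, if cliqueVec Q e = true ∧ u e = false then (1 : ℝ) else 0) - ε) =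
      ∑ Q ∈ (Finset.univ : Finset (Fin m)).powersetCard k,
        ψ Q * (∑ e, if cliqueVec Q e = true ∧ u e = false then (1 : ℝ) else 0) -
      ε * ∑ Q ∈ (Finset.univ : Finset (Fin m)).powersetCard k, ψ Q := by
    rw [Finset.mul_sum, ← Finset.sum_sub_distrib]
    exact Finset.sum_congr rfl fun Q _ => by ring
  rw [hsplit]
  have : 0 < ε * ∑ Q ∈ (Finset.univ : Finset (Fin m)).powersetCard k, ψ Q := mul_pos hε hpos
  linarith

/-- **ε-uniform lower bound for the LP slice.** If a finite family `𝒰` of columns carries ε-free valid tests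
(`∑_Q ψ_u D[Q,u] ≤ 0 < ∑_Q ψ_u`) such that no `a ≥ 0` on `k`-sets is caught by more than `N` members, and `r · N < #𝒰`,
then for EVERY `ε > 0` there is no non-negative factorisation `D[Q,u] - ε = ∑_{l<r} U_{u,l} V_{l,Q}` with `U, V ≥ 0` —
the `q = 0` (LP) slice of the canonical cone-rank statement at this `m`, uniformly in `ε`. [folklore counting] -/
theorem lpConeRank_ge_of_testCover : ∀ {m k r N : ℕ}
    (𝒰 : Finset ((⊤ : SimpleGraph (Fin m)).edgeSet → Bool))
    (ψ : ((⊤ : SimpleGraph (Fin m)).edgeSet → Bool) → Finset (Fin m) → ℝ),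
    (∀ u ∈ 𝒰, ∑ Q ∈ (Finset.univ : Finset (Fin m)).powersetCard k,
      ψ u Q * (∑ e, if cliqueVec Q e = true ∧ u e = false then (1 : ℝ) else 0) ≤ 0) →
    (∀ u ∈ 𝒰, 0 < ∑ Q ∈ (Finset.univ : Finset (Fin m)).powersetCard k, ψ u Q) →
    (∀ a : Finset (Fin m) → ℝ, (∀ Q : Finset (Fin m), Q.card = k → 0 ≤ a Q) →
      (𝒰.filter fun u => ∑ Q ∈ (Finset.univ : Finset (Fin m)).powersetCard k, ψ u Q * a Q < 0).card ≤ N) →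
    r * N < 𝒰.card →
    ∀ ε : ℝ, 0 < ε →
      ∀ (U : ((⊤ : SimpleGraph (Fin m)).edgeSet → Bool) → Fin r → ℝ) (V : Fin r → Finset (Fin m) → ℝ),
        (∀ u l, 0 ≤ U u l) → (∀ l Q, 0 ≤ V l Q) →
        ¬ ∀ u ∈ 𝒰, ∀ Q : Finset (Fin m), Q.card = k →
            (∑ e, if cliqueVec Q e = true ∧ u e = false then (1 : ℝ) else 0) - ε = ∑ l, U u l * V l Q := by
  intro m k r N 𝒰 ψ hD hpos hN hbig ε hε U V hU hV hfact
  have h := card_le_mul_of_testCover U V hU hV ε 𝒰 hfact ψ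
    (fun u hu => testCover_valid_of_le_of_pos (ψ u) u ε hε (hD u hu) (hpos u hu)) hN
  omega

/-- **Test-cover families prove the LP slice of the crux (asymptotic form).** Fix `δ`. Suppose that for every `c`,
eventually in `m`, there are a finite family `𝒰` of `⌈m^δ⌉₊`-clique-free graphs of `K_m`, ε-free valid tests `ψ_u`
(`∑_Q ψ_u(Q) D[Q,u] ≤ 0 < ∑_Q ψ_u(Q)` over the `⌈m^δ⌉₊`-sets) and a bound `N` on the number of members of `𝒰` caught by
any one non-negative function on the `⌈m^δ⌉₊`-sets, with `m^c · N < #𝒰`. Then the LP slice (`q = 0`) of the canonical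
cone-rank statement holds for `δ`: for every `c`, eventually, for every `ε > 0`, `D - εJ` has no non-negative
factorisation with `r ≤ m^c` terms (the ε-form left-hand side of `cliqueDist_rankHard_iff_strictRankHard`). This is the
SUPPORT target the method isolates: exhibit such families with `#𝒰/N` superpolynomial. [folklore counting] -/
theorem lpSliceHard_of_testCoverFamilies (δ : ℝ)
    (hfam : ∀ c : ℕ, ∀ᶠ m : ℕ in Filter.atTop, ∃ (𝒰 : Finset ((⊤ : SimpleGraph (Fin m)).edgeSet → Bool))
      (ψ : ((⊤ : SimpleGraph (Fin m)).edgeSet → Bool) → Finset (Fin m) → ℝ) (N : ℕ),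
      (∀ u ∈ 𝒰, cliqueFn m ⌈(m : ℝ) ^ δ⌉₊ u = false) ∧
      (∀ u ∈ 𝒰, ∑ Q ∈ (Finset.univ : Finset (Fin m)).powersetCard ⌈(m : ℝ) ^ δ⌉₊,
        ψ u Q * (∑ e, if cliqueVec Q e = true ∧ u e = false then (1 : ℝ) else 0) ≤ 0) ∧
      (∀ u ∈ 𝒰, 0 < ∑ Q ∈ (Finset.univ : Finset (Fin m)).powersetCard ⌈(m : ℝ) ^ δ⌉₊, ψ u Q) ∧
      (∀ a : Finset (Fin m) → ℝ, (∀ Q : Finset (Fin m), Q.card = ⌈(m : ℝ) ^ δ⌉₊ → 0 ≤ a Q) →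
        (𝒰.filter fun u => ∑ Q ∈ (Finset.univ : Finset (Fin m)).powersetCard ⌈(m : ℝ) ^ δ⌉₊, ψ u Q * a Q < 0).card ≤ N) ∧
      m ^ c * N < 𝒰.card) :
    ∀ c : ℕ, ∀ᶠ m : ℕ in Filter.atTop, ∀ ε : ℝ, 0 < ε → ∀ r : ℕ, r ≤ m ^ c →
      ∀ (U : ((⊤ : SimpleGraph (Fin m)).edgeSet → Bool) → Fin r → ℝ) (V : Fin r → Finset (Fin m) → ℝ),
        (∀ u l, 0 ≤ U u l) → (∀ l Q, 0 ≤ V l Q) →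
        ¬ ∀ (Q : Finset (Fin m)) (u : (⊤ : SimpleGraph (Fin m)).edgeSet → Bool), Q.card = ⌈(m : ℝ) ^ δ⌉₊ →
            cliqueFn m ⌈(m : ℝ) ^ δ⌉₊ u = false →
              (∑ e, if cliqueVec Q e = true ∧ u e = false then (1 : ℝ) else 0) - ε = ∑ l, U u l * V l Q := by
  intro c
  filter_upwards [hfam c] with m hm
  obtain ⟨𝒰, ψ, N, hcf, hD, hpos, hN, hbig⟩ := hm
  intro ε hε r hr U V hU hV hfact
  have hbig' : r * N < 𝒰.card := lt_of_le_of_lt (Nat.mul_le_mul_right N hr) hbig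
  exact lpConeRank_ge_of_testCover 𝒰 ψ hD hpos hN hbig' ε hε U V hU hV
    (fun u hu Q hQ => hfact Q u hQ (hcf u hu))

end Summit.PneNP.PneNP.Theorems
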